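import Mathlib
import Summits.Ventures.HodgeRepro2.Tier7.Line1.SignData

/-!
# Tier 7 — LINE 1: the parity condition is AUTOMATIC under the multiplicity formula (`Line1/ParityAuto.lean`; t7-L1-p3)

Second prover product of t7-L1-p3 for LINE 1 (plan-1 «YES», STATUS l. 14740): the displayed structure `MultData`
(member signs `δ σ v`, packet sign `ε σ` with `ε (tw σ) = ε σ`, the multiplicity formula `∏_{v ∈ supp σ} δ σ v = ε σ`
for every constituent, the swap rule `δ (tw σ) v = −δ σ v` exactly at the two-member places of the swap set) over the
landed `SignData` (p662337), and the kernel theorem `even_filter_of_multData`: for EVERY constituent `σ` the number of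
two-member places of the swap set is even. Consequences: `MultData.cA_eq_cB_of_swapOK` (sign compatibility forces
`cA = cB`), `MultData.not_two_torus_of_ne` (`cA ≠ cB` kills the two-torus statement outright), `MultData.parity_trivial`
(with `cA = cB` the parity condition of `parity_of_swapOK` holds for every `σ`).

WHAT IT SAYS. This is the honest sharpening of LEMMAS.md §2(e): under the printed multiplicity formula the parity
condition cuts NO candidate — the reduction (a)–(e) of the line restricts (f) by the sign compatibility alone, and (f)
(two toric periods non-zero on one sign-compatible `σ`) stays the whole residual. Nothing here asserts a
non-vanishing or consumes a field of the frozen target; the content is finite combinatorics in `ℤˣ` over displayed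
printed facts (locators in proofs/t7/INPUTS.md; paper note HOME proofs/t7/L1/PARITY-p3.md §4). Imports: `Mathlib` +
`Summits.Ventures.HodgeRepro2.Tier7.Line1.SignData` (→ `Line1.TwoTorus` → `Line1.Defs` → `Tier7.Target`). Sorry-free;
axioms of every theorem: propext / Classical.choice / Quot.sound.
§8(d): uses an L-value-free non-vanishing device: NO (it proves no non-vanishing; it removes a claimed constraint).
-/

namespace Summit.Ventures.HodgeRepro2.Tier7.Line1

open Summit.Ventures.HodgeRepro2.Tier7

section

variable {K : Type} [Field K] [NumberField K] {E' : Type} [Field E'] [NumberField E']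
  {V : Type} [AddCommGroup V] [Module E' V] {HX : Type} [Ring HX] [Algebra ℂ HX]
  {G : Type} [Group G] [MulAction G HX] (D : PeriodDatum K E' V HX G)

/-! ## 9. The parity condition is AUTOMATIC under the multiplicity formula (t7-L1-p3; record for LEMMAS.md §2(e))

The member of a two-member local packet that a transported constituent `σ ∘ Ad(g⁻¹)` occupies is the OTHER one exactly
at the places `v ∈ S` (where `Ad(g_v)` is outer); the transported constituent is automorphic (`g ∈ GU(W)(F)` is
rational) and lies in the same global packet; the multiplicity formula of the packet (Labesse–Langlands 1979 shape;
Rogawski 1990 §11 for `U(2)`) says «a member is automorphic iff the product of its member signs is the packet sign».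
Hence the member signs of `σ` and of `σ ∘ Ad(g⁻¹)` have the same product while differing at exactly
`#{v ∈ S : two-member}` places — that number is EVEN for EVERY automorphic `σ`. So the parity condition of
`parity_of_swapOK` cuts no candidate: with `cA = cB` it is satisfied by every `σ`, and with `cA ≠ cB` no `σ` is
sign-compatible at all. CONVENTION (the member signs are the characters `⟨σ_v, s⟩` of the global component group of
the packet): for a STABLE (non-endoscopic) packet the component group is trivial, every member sign is `+1`, and
`two σ v` must then be read as «the two local members are distinguished by the global component group» — for the
CM-type candidates of the line (endoscopic packets, Rogawski Ch. 11) this is «the local packet of `σ_v` has two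
members» as in `SignData`. Every field of `MultData` is a displayed printed fact about the real objects (locators in
proofs/t7/INPUTS.md); the theorem is finite combinatorics in `ℤˣ`. -/

/-- MULTIPLICITY DATA over the sign data `N` of a transport: `delta σ v` = the member sign `⟨σ_v, s⟩` of `σ_v` inside
its local packet (`+1` where the packet is not split by the global component group), `eps σ` = the global sign of the
packet of `σ`; `mult` = the multiplicity formula «every automorphic member has `∏_v δ_v = ε`» over `N.supp σ`
(Labesse–Langlands 1979 / Rogawski 1990 §11 shape; locator in INPUTS.md); `eps_tw`, `supp_tw` = the transport
`σ ∘ Ad(g⁻¹)` stays in the packet (same base change); `delta_tw_swap` / `delta_tw_fix` = `Ad(g_v)` exchanges the two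
members exactly at the two-member places of the swap set `N.S` (`η_v(u) = −1`: `Ad(g_v)` outer) and fixes `σ_v`
elsewhere (`Ad(g_v)` inner). -/
structure MultData (T : TwoTorusData D) (R : TransportData D T) (N : SignData D T R) where
  delta : T.Cons → N.Place → ℤˣ
  eps : T.Cons → ℤˣ
  mult : ∀ σ, ∏ v ∈ N.supp σ, delta σ v = eps σ
  eps_tw : ∀ σ, eps (R.tw σ) = eps σ
  supp_tw : ∀ σ, N.supp (R.tw σ) = N.supp σ
  delta_tw_swap : ∀ σ v, v ∈ N.S → N.two σ v = true → delta (R.tw σ) v = -delta σ v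
  delta_tw_fix : ∀ σ v, ¬ (v ∈ N.S ∧ N.two σ v = true) → delta (R.tw σ) v = delta σ v

namespace MultData

variable {D} {T : TwoTorusData D} {R : TransportData D T} {N : SignData D T R}

/-- (PROVED) the product of the member signs of the transported constituent is `(−1)^{#(S ∩ two σ)}` times that of
`σ` -/
theorem prod_delta_tw (M : MultData D T R N) (σ : T.Cons) :
    ∏ v ∈ N.supp σ, M.delta (R.tw σ) v =
      (-1) ^ (N.S.filter (fun v => N.two σ v = true)).card * ∏ v ∈ N.supp σ, M.delta σ v := by
  classical
  have h1 : ∀ v ∈ N.supp σ, M.delta (R.tw σ) v =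
      (if v ∈ N.S ∧ N.two σ v = true then (-1 : ℤˣ) else 1) * M.delta σ v := by
    intro v _
    split_ifs with hv
    · rw [M.delta_tw_swap σ v hv.1 hv.2, neg_one_mul]
    · rw [M.delta_tw_fix σ v hv, one_mul]
  rw [Finset.prod_congr rfl h1, Finset.prod_mul_distrib, Finset.prod_ite, Finset.prod_const_one, mul_one,
    Finset.prod_const]
  congr 3
  ext v
  simp only [Finset.mem_filter]
  exact ⟨fun hv => ⟨hv.2.1, hv.2.2⟩, fun hv => ⟨N.S_subset σ hv.1, hv.1, hv.2⟩⟩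

end MultData

/-- **(PROVED) THE PARITY CONDITION IS AUTOMATIC**: under multiplicity data, for EVERY constituent `σ` the number of
two-member places of the swap set is even — the multiplicity formula applied to `σ` and to its transport forces it
(`ε = ∏ δ(tw σ) = (−1)^{#(S ∩ two σ)} · ∏ δ(σ) = (−1)^{#(S ∩ two σ)} · ε`). -/
theorem even_filter_of_multData (T : TwoTorusData D) (R : TransportData D T) (N : SignData D T R)
    (M : MultData D T R N) (σ : T.Cons) : Even (N.S.filter (fun v => N.two σ v = true)).card := by
  have h := M.mult (R.tw σ)
  rw [M.supp_tw σ, M.eps_tw σ, M.prod_delta_tw σ, M.mult σ] at h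
  have h1 : (-1 : ℤˣ) ^ (N.S.filter (fun v => N.two σ v = true)).card = 1 :=
    mul_right_cancel (h.trans (one_mul _).symm)
  exact (neg_one_pow_eq_one_iff_even (by decide)).mp h1

namespace MultData

variable {D} {T : TwoTorusData D} {R : TransportData D T} {N : SignData D T R}

/-- (PROVED) consequence for `parity_of_swapOK`: under multiplicity data a sign-compatible constituent forces
`cA = cB` — the parity constraint of LEMMAS.md §2(e) is a CONSISTENCY condition on the two global constants, never a
condition on `σ` -/
theorem cA_eq_cB_of_swapOK (M : MultData D T R N) (σ : T.Cons) (h : R.swapOK σ) : N.cA = N.cB :=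
  (parity_of_swapOK D T R N σ h).mp (even_filter_of_multData D T R N M σ)

/-- (PROVED) hence with `cA ≠ cB` NO constituent is sign-compatible and the two-torus statement is false — the
obstruction of `not_two_torus_of_parity` in its sharp form -/
theorem not_two_torus_of_ne (M : MultData D T R N) (hne : N.cA ≠ N.cB) : ¬ TwoTorus D T :=
  not_two_torus_of_no_swapOK D T R (fun σ h => hne (M.cA_eq_cB_of_swapOK σ h))

/-- (PROVED) and with `cA = cB` the parity condition of `parity_of_swapOK` holds for EVERY constituent: it excludes
nothing — the residual (f) of LEMMAS.md §2 is untouched by the parity -/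
theorem parity_trivial (M : MultData D T R N) (hc : N.cA = N.cB) (σ : T.Cons) :
    Even (N.S.filter (fun v => N.two σ v = true)).card ↔ N.cA = N.cB :=
  ⟨fun _ => hc, fun _ => even_filter_of_multData D T R N M σ⟩

end MultData

end

end Summit.Ventures.HodgeRepro2.Tier7.Line1
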